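import Summits.BirchSwinnertonDyer.Rank1Residual.GaloisImage.KuriharaRecordBSDpThreeLevelOne
import Literature.NumberTheory.EllipticCurves.CongruenceVisibilityLocalFactors
import Literature.NumberTheory.EllipticCurves.CongruenceVisibilityRefinedCertificate
import Literature.NumberTheory.EllipticCurves.Rank1Residual.Typed.CasselsLowerBound
import Literature.NumberTheory.EllipticCurves.Rank1Residual.Typed.X11Visibility
import HarnessLib

/-!
# The VISIBLE (congruence) lower bound at additive `3`: `9 ∣ #Ш(E)[3^∞]` from a `3`-congruent
# partner of rank `≥ 2`, and the N11 ENDs it feeds (cell `b2b-bsdres`, team n1011, row T-VIS3 (ii) =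
# route planner 1's §40.3 (d) / R1-74; seat p04 GEN 9; skeleton `cells/n1011/skel/T-VIS3.md`)

HONEST FRAMING (cell `b2b-bsdres`, run/shared/lean/b2b/bsd-rank1-residual/, verbatim in every
file): the goal of the cell is to DELETE the COMBINATION-SHAPED residual classes of the
Birch–Swinnerton-Dyer formula for ALL analytic-rank `≤ 1` elliptic curves over `ℚ` — "full BSD
formula for every rank `≤ 1` curve in class `C`" assembled STRICTLY from published theorems — so
that the rank-`≤ 1` remainder becomes exactly the CONSTRUCTION-SHAPED classes, which are TYPED
(missing-input `Prop`s), NOT attempted. This is not "finishing BSD". Team n1011 (N10 / N11, the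
additive block X4 ∧ `p = 3`): research route on the CONSTRUCTION-SHAPED class X4; no claim beyond
the stated classes; nothing is booked; no mark / label / count is changed by this file. Theorems
only (no definition, no named fact, no `sorry`). The ENDs of §4 close NO class by themselves: the
per-row congruence certificate (the `Γ_ℚ`-isomorphism `θ : E′[3] ≃ E[3]`, the partner's rank, the
local `3`-torsion counts) is an INPUT, and the UPPER-half binders of the N11 sockets are unchanged.

## What

Route planner 1 (ROUTE-1 §40.3, V40) found, for 42 of the 74 LOWER-open N11 rows `E` (rank `0`,
`#Ш(E)_an = 9`, additive at `3`), a `3`-congruent curve `E′` of rank `2` (the Cremona–Mazur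
"`Ш` explained by a congruent curve" configuration).  Printed visibility does not reach `9 ∣ N`
(Agashe–Stein needs `p ∤ N`, Cremona–Mazur `p² ∤ N`); but the tree already holds the VISIBILITY
COUNT with `p ∣ N` allowed and NO hypothesis at the places above `p` (x11a gens 9–10, cell-independent
Literature theorems): `WeierstrassCurve.exists_sha_ne_zero_of_congr_of_rank` — for an odd prime
`p`, `θ : E′[p] ≃ E[p]` `Γ_K`-equivariant, `S ⊇` bad places of both curves `∪ {v ∣ p}`, `E(K)`
finite of order prime to `p`, `E′(K_v)[p] = 0` for `v ∈ S` and `rank E′(K) ≥ [K:ℚ] + 1`, there is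
`c ∈ Ш(E/K)`, `c ≠ 0`, `p c = 0` — and its refined certificate form
`exists_sha_ne_zero_of_congr_of_places` (pay `#E′(K_v)[p] · #(𝓞_v/p)` at chosen places, free kinds
elsewhere; multiplicative kinds under the Tate-uniformisation facts `hU`, `hU2`).

This file is the N11 ASSEMBLY at `K = ℚ`, `p = 3` (`[K:ℚ] + 1 = 2`, the place of `3` costs
`#(ℤ₃/3) = 3 < 9 ≤ 3^{rank E′}` once `E′(ℚ₃)[3] = 0`):
* §1 `sq_dvd_card_sha_three_of_exists_sha_torsion`: a non-zero `3`-torsion class in `Ш(E)` gives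
  `3² ∣ #Ш(E)[3^∞]` by the Cassels–Tate parity (`hCT`, the tree's A24;
  `Assembly.sq_dvd_card_sha_three_of_dvd_of_casselsTate`);
* §2 `sq_dvd_card_sha_three_of_congr_of_rank` (the pure certificate: `θ`, `S`, `E(ℚ)` finite with
  `3 ∤ #E(ℚ)`, `rank E′ ≥ 2`, `#E′(ℚ_v)[3] = 1` for `v ∈ S`), its twin `…_of_congr_int_of_rank` in the
  `(3 : ℤ)` torsion-index currency of the congruence producers (`Fisher2012.threeCongruent_of_hesseCertificate`),
  and `…_of_places` (refined); a
  certificate needing a per-place AGREEMENT argument at some bad place (`θ_* 𝓢_v(E′) ≤ 𝓢_v(E)`)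
  goes through the tree's hook `exists_sha_ne_zero_of_congr_of_le_off` and then §1;
* §3 `dvd_shaOrder_three_of_congr_of_rank` (`3 ∣ #Ш(E)`, fact-free) and
  `missingLowerBoundAt_three_of_congr_of_rank` — the LOWER binder `MissingLowerBoundAt W 3` of the
  route (`Typed.missingLowerBoundAt_of_casselsTate_of_pow_dvd`), given `#Ш_an = q`, `ord₃ q ≤ 2`;
* §4 the two N11 END sockets of n1011-p18 (`Assembly.bsdp_three_of_towerSurj_of_sq_dvd_card_sha`,
  `…potMult…`) with their input `h9 : 3² ∣ #Ш(E)[3^∞]` supplied by §2: `BSDp W 3` on a row from the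
  UPPER binders, the level-zero unit `δ̃_1 ≢ 0 (mod 27)` and a congruence certificate.

References: J. E. Cremona, B. Mazur, *Visualizing elements in the Shafarevich–Tate group*,
Experiment. Math. 9 (2000) §3 and Table 1 [CremonaMazur2000]; A. Agashe, W. Stein, J. Number Theory
97 (2002) Thm. 3.1 [AgasheStein2002]; B. Mazur, K. Rubin, Invent. Math. 181 (2010) Lemma 3.2;
J. H. Silverman, *AEC* X.4 [SilvermanAEC2009]; R. L. Miller, LMS J. Comput. Math. 14 (2011) Def. 1.1
[Miller2011LMS].
-/

noncomputable section

open scoped Classical NumberField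
open Function Field NumberField IsDedekindDomain WeierstrassCurve CongruenceSubgroup
open Literature.NumberTheory.EllipticCurves Literature.NumberTheory.EllipticCurves.ModularForms
  Literature.NumberTheory.EllipticCurves.Rank1Residual
  Literature.NumberTheory.EllipticCurves.Rank1Residual.Typed
  Literature.NumberTheory.EllipticCurves.AgasheRibetStein2006
  Literature.NumberTheory.GaloisRepresentations

namespace Summit.BirchSwinnertonDyer.Rank1Residual.GaloisImage

namespace Visible

/-! ### §1. A `3`-torsion class in `Ш` and the Cassels–Tate parity -/

/-- **A non-zero `3`-torsion element of `Ш(E/ℚ)` gives `3² ∣ #Ш(E)[3^∞]`** (for `Ш(E)` finite, by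
the Cassels–Tate parity): the element has order `3` and lies in the `3`-primary part, so
`3 ∣ #Ш(E)[3^∞]`, whose `3`-adic valuation is even.  The square step is the tree's
`Assembly.sq_dvd_card_sha_three_of_dvd_of_casselsTate` ← `X4.even_padicValNat_card_shaPrimary_of_casselsTate`
← `WeierstrassCurve.isSquare_shaOrder_of_casselsTate`, all from the NAMED FACT
`hCT : WeierstrassCurve.exists_casselsTate_pairing (K := ℚ)` (Cassels 1962 / Tate; the cell's A24).
[cite: SilvermanAEC2009, Thm. X.4.14] -/
theorem sq_dvd_card_sha_three_of_exists_sha_torsion (hCT : exists_casselsTate_pairing (K := ℚ))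
    (W : WeierstrassCurve ℚ) [W.IsElliptic] [Finite W.sha]
    (h : ∃ c : W.sha, c ≠ 0 ∧ 3 • c = 0) :
    3 ^ 2 ∣ Nat.card (AddCommGroup.primaryComponent W.sha 3) := by
  haveI : Fact (Nat.Prime 3) := ⟨Nat.prime_three⟩
  obtain ⟨c, hc0, h3c⟩ := h
  have hord : addOrderOf c = 3 := addOrderOf_eq_prime h3c hc0
  have hmem : c ∈ AddCommGroup.primaryComponent W.sha 3 :=
    (AddCommGroup.mem_primaryComponent_iff_addOrderOf (G := W.sha) (p := 3)).mpr ⟨1, by rw [hord, pow_one]⟩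
  have h3 : 3 ∣ Nat.card (AddCommGroup.primaryComponent W.sha 3) := by
    have h := addOrderOf_dvd_natCard (⟨c, hmem⟩ : AddCommGroup.primaryComponent W.sha 3)
    rwa [AddSubgroup.addOrderOf_mk, hord] at h
  exact Assembly.sq_dvd_card_sha_three_of_dvd_of_casselsTate hCT W h3

/-! ### §2. The visible lower bound from a `3`-congruent partner of rank `≥ 2` -/

/-- **The visible lower bound at additive `3` — pure certificate.**  Let `E = W` and `E′` be
elliptic curves over `ℚ`, `θ : E′[3] ≃ E[3]` a `Γ_ℚ`-isomorphism (a `3`-congruence), `S` a finite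
set of finite places outside which both curves have good reduction and which contains the place of
`3`; assume `E(ℚ)` is finite of order prime to `3`, `rank E′(ℚ) ≥ 2`, and `E′(ℚ_v)[3] = 0` for every
`v ∈ S` (in particular `E′(ℚ₃)[3] = 0`).  Then `3² ∣ #Ш(E)[3^∞]` (for `Ш(E)` finite, Cassels–Tate).
NO reduction hypothesis at `3`: `E` may be additive there.  The tree's visibility count
(`exists_sha_ne_zero_of_congr_of_rank`: the place of `3` costs `#(ℤ₃/3) = 3 < 9 ≤ 3^{rank E′}`) and §1.
[cite: CremonaMazur2000, §3 and Table 1] [cite: AgasheStein2002, Thm. 3.1 and §3.5]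
[cite: SilvermanAEC2009, Thm. X.4.14] -/
theorem sq_dvd_card_sha_three_of_congr_of_rank (hCT : exists_casselsTate_pairing (K := ℚ))
    (W E' : WeierstrassCurve ℚ) [W.IsElliptic] [E'.IsElliptic] [Finite W.sha]
    (θ : geomTorsion E' ((3 : ℕ) : ℤ) ≃+ geomTorsion W ((3 : ℕ) : ℤ))
    (hθ : ∀ (σ : absoluteGaloisGroup ℚ) (P : geomTorsion E' ((3 : ℕ) : ℤ)), θ (σ • P) = σ • θ P)
    (S : Finset (HeightOneSpectrum (𝓞 ℚ)))
    (hS : ∀ v : HeightOneSpectrum (𝓞 ℚ), v ∉ S →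
      W.HasGoodReductionAt v ∧ E'.HasGoodReductionAt v ∧ ((3 : ℕ) : 𝓞 ℚ) ∉ v.asIdeal)
    (hfin : Finite W.toAffine.Point) (hcop : (Nat.card W.toAffine.Point).Coprime 3)
    (hrank : 2 ≤ E'.mordellWeilRank)
    (hloc : ∀ v ∈ S, Nat.card (nsmulAddMonoidHom 3 :
      (E'.baseChange (v.adicCompletion ℚ)).toAffine.Point →+ _).ker = 1) :
    3 ^ 2 ∣ Nat.card (AddCommGroup.primaryComponent W.sha 3) := by
  haveI : Fact (Nat.Prime 3) := ⟨Nat.prime_three⟩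
  refine sq_dvd_card_sha_three_of_exists_sha_torsion hCT W ?_
  have hrank' : Module.finrank ℚ ℚ + 1 ≤ E'.mordellWeilRank := by rwa [Module.finrank_self]
  exact W.exists_sha_ne_zero_of_congr_of_rank E' (by norm_num) θ hθ S hS hfin hcop hrank' hloc

/-- **The same in the `ℤ`-literal currency of the congruence producers** (`θ : E′[3] ≃ E[3]` on
`geomTorsion · (3 : ℤ)`, as delivered by the tree's Hesse-pencil theorem
`Fisher2012.threeCongruent_of_hesseCertificate`; the visibility theorems index the torsion by
`((3 : ℕ) : ℤ)` — the two agree definitionally). [cite: CremonaMazur2000, §3 and Table 1]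
[cite: SilvermanAEC2009, Thm. X.4.14] -/
theorem sq_dvd_card_sha_three_of_congr_int_of_rank (hCT : exists_casselsTate_pairing (K := ℚ))
    (W E' : WeierstrassCurve ℚ) [W.IsElliptic] [E'.IsElliptic] [Finite W.sha]
    (θ : geomTorsion E' (3 : ℤ) ≃+ geomTorsion W (3 : ℤ))
    (hθ : ∀ (σ : absoluteGaloisGroup ℚ) (P : geomTorsion E' (3 : ℤ)), θ (σ • P) = σ • θ P)
    (S : Finset (HeightOneSpectrum (𝓞 ℚ)))
    (hS : ∀ v : HeightOneSpectrum (𝓞 ℚ), v ∉ S →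
      W.HasGoodReductionAt v ∧ E'.HasGoodReductionAt v ∧ ((3 : ℕ) : 𝓞 ℚ) ∉ v.asIdeal)
    (hfin : Finite W.toAffine.Point) (hcop : (Nat.card W.toAffine.Point).Coprime 3)
    (hrank : 2 ≤ E'.mordellWeilRank)
    (hloc : ∀ v ∈ S, Nat.card (nsmulAddMonoidHom 3 :
      (E'.baseChange (v.adicCompletion ℚ)).toAffine.Point →+ _).ker = 1) :
    3 ^ 2 ∣ Nat.card (AddCommGroup.primaryComponent W.sha 3) :=
  sq_dvd_card_sha_three_of_congr_of_rank hCT W E' θ hθ S hS hfin hcop hrank hloc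

/-- **The visible lower bound at additive `3` — refined certificate** (pay at `T`, agree off `T`):
as `sq_dvd_card_sha_three_of_congr_of_rank`, but with a lossy subset `T ⊆ S` whose cost
`∏_{w ∈ T} #E′(ℚ_w)[3] · #(ℤ_w/3)` is `< 3^{rank E′}`, and every `w ∈ S \ T` of one of the three free
kinds of the tree's `exists_sha_ne_zero_of_congr_of_places`: (i) `w ∤ 3` and `E′(ℚ_w)[3] = 0`;
(ii) both curves split multiplicative at `w` with `#E(ℚ_w)[3] ≤ 3` (Tate, `hU`); (iii) both
multiplicative of the same twist type at `w` with `μ₃(ℚ_w) = 1` (`hU2`).  CONDITIONAL on the two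
Tate-uniformisation named facts when kinds (ii)/(iii) are used.
[cite: CremonaMazur2000, §3 and Table 1] [cite: SilvermanATAEC1994, Ch. V Thm. 3.1, Thm. 5.3, Cor. 5.4]
[cite: SilvermanAEC2009, Thm. X.4.14] -/
theorem sq_dvd_card_sha_three_of_congr_of_places
    (hU : Silverman1994_thmV53_tateUniformisation.{0})
    (hU2 : Silverman1994_thmV53_corV54_tateUniformisation.{0})
    (hCT : exists_casselsTate_pairing (K := ℚ))
    (W E' : WeierstrassCurve ℚ) [W.IsElliptic] [E'.IsElliptic] [Finite W.sha]
    (θ : geomTorsion E' ((3 : ℕ) : ℤ) ≃+ geomTorsion W ((3 : ℕ) : ℤ))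
    (hθ : ∀ (σ : absoluteGaloisGroup ℚ) (P : geomTorsion E' ((3 : ℕ) : ℤ)), θ (σ • P) = σ • θ P)
    (S T : Finset (HeightOneSpectrum (𝓞 ℚ))) (hTS : T ⊆ S)
    (hS : ∀ w : HeightOneSpectrum (𝓞 ℚ), w ∉ S →
      W.HasGoodReductionAt w ∧ E'.HasGoodReductionAt w ∧ ((3 : ℕ) : 𝓞 ℚ) ∉ w.asIdeal)
    (hfin : Finite W.toAffine.Point) (hcop : (Nat.card W.toAffine.Point).Coprime 3)
    (hT : (∏ w ∈ T, Nat.card (nsmulAddMonoidHom 3 :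
        (E'.baseChange (w.adicCompletion ℚ)).toAffine.Point →+ _).ker *
        Nat.card (w.adicCompletionIntegers ℚ ⧸
          Ideal.span {((3 : ℕ) : w.adicCompletionIntegers ℚ)})) < 3 ^ E'.mordellWeilRank)
    (hplaces : ∀ w ∈ S, w ∉ T →
      (((3 : ℕ) : 𝓞 ℚ) ∉ w.asIdeal ∧ Nat.card (nsmulAddMonoidHom 3 :
          (E'.baseChange (w.adicCompletion ℚ)).toAffine.Point →+ _).ker = 1) ∨
      (W.HasSplitMultiplicativeReductionAt w ∧ E'.HasSplitMultiplicativeReductionAt w ∧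
        Nat.card (nsmulAddMonoidHom 3 :
          (W.baseChange (w.adicCompletion ℚ)).toAffine.Point →+ _).ker ≤ 3) ∨
      (W.HasMultiplicativeReductionAt w ∧ E'.HasMultiplicativeReductionAt w ∧
        (∃ r : w.adicCompletion ℚ, algebraMap ℚ (w.adicCompletion ℚ) (-(W.c₄ / W.c₆)) =
          r ^ 2 * algebraMap ℚ (w.adicCompletion ℚ) (-(E'.c₄ / E'.c₆))) ∧
        (∀ ζ : w.adicCompletion ℚ, ζ ^ 3 = 1 → ζ = 1))) :
    3 ^ 2 ∣ Nat.card (AddCommGroup.primaryComponent W.sha 3) := by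
  haveI : Fact (Nat.Prime 3) := ⟨Nat.prime_three⟩
  refine sq_dvd_card_sha_three_of_exists_sha_torsion hCT W ?_
  exact W.exists_sha_ne_zero_of_congr_of_places hU hU2 (by norm_num) E' θ hθ S T hTS hS hfin hcop hT
    hplaces


/-! ### §3. The typed LOWER binder `MissingLowerBoundAt W 3` -/

/-- **`3 ∣ #Ш(E)` from a `3`-congruent partner of rank `≥ 2`** (pure certificate; fact-free — no
Cassels–Tate, no finiteness of `Ш`: `#Ш := Nat.card`). [cite: CremonaMazur2000, §3 and Table 1] -/
theorem dvd_shaOrder_three_of_congr_of_rank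
    (W E' : WeierstrassCurve ℚ) [W.IsElliptic] [E'.IsElliptic]
    (θ : geomTorsion E' ((3 : ℕ) : ℤ) ≃+ geomTorsion W ((3 : ℕ) : ℤ))
    (hθ : ∀ (σ : absoluteGaloisGroup ℚ) (P : geomTorsion E' ((3 : ℕ) : ℤ)), θ (σ • P) = σ • θ P)
    (S : Finset (HeightOneSpectrum (𝓞 ℚ)))
    (hS : ∀ v : HeightOneSpectrum (𝓞 ℚ), v ∉ S →
      W.HasGoodReductionAt v ∧ E'.HasGoodReductionAt v ∧ ((3 : ℕ) : 𝓞 ℚ) ∉ v.asIdeal)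
    (hfin : Finite W.toAffine.Point) (hcop : (Nat.card W.toAffine.Point).Coprime 3)
    (hrank : 2 ≤ E'.mordellWeilRank)
    (hloc : ∀ v ∈ S, Nat.card (nsmulAddMonoidHom 3 :
      (E'.baseChange (v.adicCompletion ℚ)).toAffine.Point →+ _).ker = 1) :
    3 ∣ W.shaOrder := by
  haveI : Fact (Nat.Prime 3) := ⟨Nat.prime_three⟩
  have hrank' : Module.finrank ℚ ℚ + 1 ≤ E'.mordellWeilRank := by rwa [Module.finrank_self]
  exact Typed.dvd_shaOrder_of_exists_torsion W 3
    (W.exists_sha_ne_zero_of_congr_of_rank E' (by norm_num) θ hθ S hS hfin hcop hrank' hloc)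

/-- **The route's LOWER binder from a congruence certificate**: `MissingLowerBoundAt W 3`
(`ord₃ #Ш(E)_an ≤ ord₃ #Ш(E)`) for a globally minimal `E = W` with `Ш(E)` finite, `#Ш(E)_an = q`
rational with `ord₃ q ≤ 2`, and a `3`-congruent partner `E′` of rank `≥ 2` as in
`sq_dvd_card_sha_three_of_congr_of_rank` (`3 ∣ #Ш` and `#Ш` a square, Cassels–Tate).
[cite: Miller2011LMS, §1 and Def. 1.1] [cite: SilvermanAEC2009, Thm. X.4.14] [cite: CremonaMazur2000, §3 and Table 1] -/
theorem missingLowerBoundAt_three_of_congr_of_rank (hCT : exists_casselsTate_pairing (K := ℚ))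
    (W E' : WeierstrassCurve ℚ) [W.IsElliptic] [W.IsGloballyMinimal] [E'.IsElliptic]
    (θ : geomTorsion E' ((3 : ℕ) : ℤ) ≃+ geomTorsion W ((3 : ℕ) : ℤ))
    (hθ : ∀ (σ : absoluteGaloisGroup ℚ) (P : geomTorsion E' ((3 : ℕ) : ℤ)), θ (σ • P) = σ • θ P)
    (S : Finset (HeightOneSpectrum (𝓞 ℚ)))
    (hS : ∀ v : HeightOneSpectrum (𝓞 ℚ), v ∉ S →
      W.HasGoodReductionAt v ∧ E'.HasGoodReductionAt v ∧ ((3 : ℕ) : 𝓞 ℚ) ∉ v.asIdeal)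
    (hfin : Finite W.toAffine.Point) (hcop : (Nat.card W.toAffine.Point).Coprime 3)
    (hrank : 2 ≤ E'.mordellWeilRank)
    (hloc : ∀ v ∈ S, Nat.card (nsmulAddMonoidHom 3 :
      (E'.baseChange (v.adicCompletion ℚ)).toAffine.Point →+ _).ker = 1)
    (hSha : W.ShaFinite) {q : ℚ} (hq : shaAn W = (q : ℂ)) (hv : padicValRat 3 q ≤ 2) :
    MissingLowerBoundAt W 3 := by
  haveI : Fact (Nat.Prime 3) := ⟨Nat.prime_three⟩
  refine Typed.missingLowerBoundAt_of_casselsTate_of_pow_dvd W 3 hCT hSha hq (k := 1)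
    (by simpa using hv) ?_
  simpa using dvd_shaOrder_three_of_congr_of_rank W E' θ hθ S hS hfin hcop hrank hloc

/-! ### §4. The N11 ENDs: `BSD(E,3)` from a congruence certificate (n1011-p18's sockets) -/

/-- **`BSD(E,3)` from a `3`-CONGRUENCE CERTIFICATE and `δ̃_1 ≢ 0 (mod 27)` — tower rows** (class
A1: tower `3`-adic surjective, `3 ∤ ∏ c_ℓ`, `N ≤ 130000`; `E′(ℚ₃)[3] = 0`, i.e. `E(ℚ₃)[3] = 0` along
`θ`, is part of `hloc`).  This is
n1011-p18's socket `Assembly.bsdp_three_of_towerSurj_of_sq_dvd_card_sha` with its input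
`h9 : 3² ∣ #Ш(E)[3^∞]` SUPPLIED by the visible lower bound `sq_dvd_card_sha_three_of_congr_of_rank`:
a `Γ_ℚ`-isomorphism `θ : E′[3] ≃ E[3]` from a partner `E′` of rank `≥ 2` with `E′(ℚ_v)[3] = 0` on a
finite `S ⊇ bad(E) ∪ bad(E′) ∪ {3}`.  Binders, verbatim: the UPPER-half NAMED FACTS of the socket
`hKatoS : Kato2004.rankZero_padicValNat_sha_le_sub_localTamagawa_of_additive_potGood_of_imageContainsSL2`,
`hDel : Delbourgo1998.prop4_rankZero_pow_dvd_constantCoeff`,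
`hGZK : rank_eq_analyticRank_of_analyticRank_le_one`, `hmod : hasEntireLFunction_rat`,
`hmodD : nonempty_modularParametrizationData`,
`hKatoχ : Wuthrich2014.kato_halfEigenCharIdeal_dvd_cyclotomicPrime_of_surjective`,
`h26 : cremona_abs_maninConstant_eq_one_of_level_le`, and `hCT : exists_casselsTate_pairing (K := ℚ)`;
the row data (`hI`, `hΔ`, `hc₄`, the tower `htower`, `hr`, `htam`, `N ≤ 130000`, the optimal datum
`D`, `hopt`); the certificate (`E′`, `θ`, `hθ`, `S`, `hS`, `hrank`, `hloc`); the level-zero unit `ψ₂₇`,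
`hunit₁`.  `Finite E(ℚ)`, `Finite Ш(E)` and `3 ∤ #E(ℚ)` are discharged inside from `hGZK`, `hr` and
surj(3) (`Typed.finite_point_of_analyticRank_eq_zero`-style, `Typed.coprime_natCard_point_of_irr`).
A SECOND `p = 3` lower-bound road (no Euler system, no port) on the rows that have a partner; closes
no class by itself.
[cite: CremonaMazur2000, §3 and Table 1] [cite: Kato2004, Thm. 14.5 (3)] [cite: Miller2011LMS, §1 and Def. 1.1] -/
theorem bsdp_three_of_towerSurj_of_congr_of_rank
    (hKatoS : Kato2004.rankZero_padicValNat_sha_le_sub_localTamagawa_of_additive_potGood_of_imageContainsSL2)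
    (hDel : Delbourgo1998.prop4_rankZero_pow_dvd_constantCoeff)
    (hGZK : rank_eq_analyticRank_of_analyticRank_le_one) (hmod : hasEntireLFunction_rat)
    (hmodD : nonempty_modularParametrizationData)
    (hKatoχ : Wuthrich2014.kato_halfEigenCharIdeal_dvd_cyclotomicPrime_of_surjective)
    (h26 : cremona_abs_maninConstant_eq_one_of_level_le)
    (hCT : exists_casselsTate_pairing (K := ℚ))
    (W : WeierstrassCurve ℚ) [W.IsElliptic] [W.IsGloballyMinimal]
    -- the row
    {E₀ : WeierstrassCurve ℤ} (hI : integralModelInt W = E₀)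
    (hΔ : (3 : ℤ) ∣ E₀.Δ) (hc₄ : (3 : ℤ) ∣ E₀.c₄)
    (htower : ∀ m : ℕ, W.HasSurjectiveModNGaloisRep (3 ^ m : ℕ))
    (hr : W.analyticRank = 0) (htam : ¬ 3 ∣ W.tamagawaProduct)
    {N : ℕ} [NeZero N] (hN : N ≤ 130000) (D : ModularParametrizationData W N)
    (hopt : ∀ z ∈ D.L.lattice, ∃ w ∈ periodLattice D.f, z = D.c * w)
    -- the congruence certificate
    (E' : WeierstrassCurve ℚ) [E'.IsElliptic]
    (θ : geomTorsion E' ((3 : ℕ) : ℤ) ≃+ geomTorsion W ((3 : ℕ) : ℤ))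
    (hθ : ∀ (σ : absoluteGaloisGroup ℚ) (P : geomTorsion E' ((3 : ℕ) : ℤ)), θ (σ • P) = σ • θ P)
    (S : Finset (HeightOneSpectrum (𝓞 ℚ)))
    (hS : ∀ v : HeightOneSpectrum (𝓞 ℚ), v ∉ S →
      W.HasGoodReductionAt v ∧ E'.HasGoodReductionAt v ∧ ((3 : ℕ) : 𝓞 ℚ) ∉ v.asIdeal)
    (hrank : 2 ≤ E'.mordellWeilRank)
    (hloc : ∀ v ∈ S, Nat.card (nsmulAddMonoidHom 3 :
      (E'.baseChange (v.adicCompletion ℚ)).toAffine.Point →+ _).ker = 1)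
    -- the level-zero unit
    (ψ₂₇ : (ℓ : ℕ) → (ZMod ℓ)ˣ →* Multiplicative (ZMod (3 ^ 3)))
    (hunit₁ : kuriharaNumber D.f (3 ^ 3) 1 ψ₂₇ ≠ 0) :
    BSDp W 3 := by
  haveI : Fact (Nat.Prime 3) := ⟨Nat.prime_three⟩
  have hGZ := hGZK W (by rw [hr]; exact zero_le_one)
  haveI : Finite W.sha := hGZ.2
  haveI hfinpt : Finite W.toAffine.Point :=
    W.mordellWeilRank_eq_zero_iff_holds.mp (by rw [hGZ.1, hr])
  have hsurj : W.HasSurjectiveModNGaloisRep 3 := by simpa using htower 1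
  have hirr : W.HasIrreducibleModPGaloisRep 3 :=
    hasIrreducibleModPGaloisRep_of_hasSurjectiveModNGaloisRep W 3 hsurj
  exact Assembly.bsdp_three_of_towerSurj_of_sq_dvd_card_sha hKatoS hDel hGZK hmod hmodD hKatoχ h26 W
    hI hΔ hc₄ htower hr htam hN D hopt
    (sq_dvd_card_sha_three_of_congr_of_rank hCT W E' θ hθ S hS hfinpt
      (Typed.coprime_natCard_point_of_irr W 3 hirr) hrank hloc) ψ₂₇ hunit₁

/-- **`BSD(E,3)` from a `3`-CONGRUENCE CERTIFICATE and `δ̃_1 ≢ 0 (mod 27)` — potentially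
MULTIPLICATIVE rows** (`ord₃ j < 0`, class A1-(M); surj(3), no tower / Tamagawa binder): n1011-p18's
socket `Assembly.bsdp_three_potMult_of_sq_dvd_card_sha` with `h9` supplied by the visible lower
bound.  These are exactly the rows route planner 1 pairs with Mazur–Rubin companions (§40.3 (d),
31 of 42); here the fact-free count replaces the companion theorem whenever `E′(ℚ_v)[3] = 0` on
`S`.  Closes no class by itself. [cite: CremonaMazur2000, §3 and Table 1]
[cite: Delbourgo1998, Prop. 4 (p. 144)] [cite: Miller2011LMS, §1 and Def. 1.1] -/
theorem bsdp_three_potMult_of_congr_of_rank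
    (hKatoS : Kato2004.rankZero_padicValNat_sha_le_sub_localTamagawa_of_additive_potGood_of_imageContainsSL2)
    (hDel : Delbourgo1998.prop4_rankZero_pow_dvd_constantCoeff)
    (hGZK : rank_eq_analyticRank_of_analyticRank_le_one) (hmod : hasEntireLFunction_rat)
    (hmodD : nonempty_modularParametrizationData)
    (hKatoχ : Wuthrich2014.kato_halfEigenCharIdeal_dvd_cyclotomicPrime_of_surjective)
    (h26 : cremona_abs_maninConstant_eq_one_of_level_le)
    (hCT : exists_casselsTate_pairing (K := ℚ))
    (W : WeierstrassCurve ℚ) [W.IsElliptic] [W.IsGloballyMinimal]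
    {E₀ : WeierstrassCurve ℤ} (hI : integralModelInt W = E₀)
    (hΔ : (3 : ℤ) ∣ E₀.Δ) (hc₄ : (3 : ℤ) ∣ E₀.c₄)
    (hsurj : W.HasSurjectiveModNGaloisRep 3) (hjneg : padicValRat 3 W.j < 0)
    (hr : W.analyticRank = 0)
    {N : ℕ} [NeZero N] (hN : N ≤ 130000) (D : ModularParametrizationData W N)
    (hopt : ∀ z ∈ D.L.lattice, ∃ w ∈ periodLattice D.f, z = D.c * w)
    (E' : WeierstrassCurve ℚ) [E'.IsElliptic]
    (θ : geomTorsion E' ((3 : ℕ) : ℤ) ≃+ geomTorsion W ((3 : ℕ) : ℤ))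
    (hθ : ∀ (σ : absoluteGaloisGroup ℚ) (P : geomTorsion E' ((3 : ℕ) : ℤ)), θ (σ • P) = σ • θ P)
    (S : Finset (HeightOneSpectrum (𝓞 ℚ)))
    (hS : ∀ v : HeightOneSpectrum (𝓞 ℚ), v ∉ S →
      W.HasGoodReductionAt v ∧ E'.HasGoodReductionAt v ∧ ((3 : ℕ) : 𝓞 ℚ) ∉ v.asIdeal)
    (hrank : 2 ≤ E'.mordellWeilRank)
    (hloc : ∀ v ∈ S, Nat.card (nsmulAddMonoidHom 3 :
      (E'.baseChange (v.adicCompletion ℚ)).toAffine.Point →+ _).ker = 1)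
    (ψ₂₇ : (ℓ : ℕ) → (ZMod ℓ)ˣ →* Multiplicative (ZMod (3 ^ 3)))
    (hunit₁ : kuriharaNumber D.f (3 ^ 3) 1 ψ₂₇ ≠ 0) :
    BSDp W 3 := by
  haveI : Fact (Nat.Prime 3) := ⟨Nat.prime_three⟩
  have hGZ := hGZK W (by rw [hr]; exact zero_le_one)
  haveI : Finite W.sha := hGZ.2
  haveI hfinpt : Finite W.toAffine.Point :=
    W.mordellWeilRank_eq_zero_iff_holds.mp (by rw [hGZ.1, hr])
  have hirr : W.HasIrreducibleModPGaloisRep 3 :=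
    hasIrreducibleModPGaloisRep_of_hasSurjectiveModNGaloisRep W 3 hsurj
  exact Assembly.bsdp_three_potMult_of_sq_dvd_card_sha hKatoS hDel hGZK hmod hmodD hKatoχ h26 W hI hΔ
    hc₄ hsurj hjneg hr hN D hopt
    (sq_dvd_card_sha_three_of_congr_of_rank hCT W E' θ hθ S hS hfinpt
      (Typed.coprime_natCard_point_of_irr W 3 hirr) hrank hloc) ψ₂₇ hunit₁

end Visible

end Summit.BirchSwinnertonDyer.Rank1Residual.GaloisImage

end
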